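import Literature.Computability.AlgebraicComplexity.LMR13FirstOrderIdentity
import Literature.Computability.AlgebraicComplexity.LMR13SubspaceTangentExcess
import Mathlib.Algebra.Polynomial.Inductions
import Mathlib.Algebra.Polynomial.Div
import Mathlib.RingTheory.Ideal.Quotient.Operations
import HarnessLib

/-!
# LMR 2013 §3.3: the first-order identity (Zar) — a form `π` is Zariski tangent to `𝒟ual_{k,d,N}`
# at a prime point `[P]` iff `P ∣ D_π det(H_P|_F) − π · Q_F` for every `F` (rungs (Z1), (Z2))

Cell val-lit (D-0074), row LMR13-A; lead-lmr g3 item (X2) «(Zar) in tree language», rungs (Z1)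
and (Z2) (FINAL SPLIT 2026-08-26T14:05Z, seat val-lit-p7 g3), on top of rung (Z0)
(`LMR13FirstOrderIdentity.lean`, val-lit-t17: `dvd_hessGenMinor_of_prime_of_mem_lmrDualScheme`,
`lmrRemainder_firstOrder_apex`).

Landsberg–Manivel–Ressayre 2013, §3.3 (journal p. 477 = arXiv:1004.4802 `p0006.txt:L57–66`):
"We differentiate the condition that `P` divides `det(H_P|_F)` for each `F`: consider a curve
`P_ε = P + επ + ε²τ + O(ε³)`. Then `P_ε` must divide `det(H_{P_ε}|_F)` … when `π` belongs to the
affine Zariski tangent space, `D_π det(H_P|_F) ≡ π Q_F (mod P)` where `det(H_P|_F) = P Q_F`." In the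
tree the affine Zariski tangent space `T̂_{[P]} 𝒟ual_{k,d,N}` (`lmrZariskiTangent`,
`LMR13DualVarieties.lean`) is DEFINED by the vanishing of the `ε¹`-coefficients of the remainder
equations `E_{B,u,v}(P + επ)` of §2.2–2.3 (`lmrDualEquation` over `ℂ[ε]`), not by divisibility; this
file proves that for a PRIME form `P` the two agree:

* `coeff_one_lmrDualEquation_firstOrderDeformation_of_eval_eq_zero` — **(Zar) at a root**: for forms
  `P, π` of degree `d ≥ 3`, `det(B·H_P·Bᵀ) = P·Q` and `u ∈ Z(P)`,
  `[ε¹] E_{B,u,v}(P+επ) = (−1)^{e−d+1} ⟨∇P(u),v⟩^{e−d+1} · (D_π(B) − π·Q)(u)`, `e = (k+3)(d−2)`;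
* `dvd_firstOrder_of_mem_lmrZariskiTangent` — **(Z1)**: `P` prime, `det(B·H_P·Bᵀ) = P·Q`,
  `π ∈ T̂_{[P]}` ⟹ `P ∣ D_π(B) − π·Q`;
* `mem_lmrZariskiTangent_of_forall_exists` — **(Z2)**: if for every `B` there are `Q, R` with
  `det(B·H_P·Bᵀ) = P·Q` and `D_π(B) = π·Q + P·R`, then `π ∈ T̂_{[P]}` (no primality);
* `mem_lmrZariskiTangent_iff_dvd_of_prime` — for prime `P ∈ 𝒟ual_{k,d,N}` of degree `d ≥ 3`:
  `π ∈ T̂_{[P]} 𝒟ual_{k,d,N} ↔ deg π = d ∧ ∀ B Q, det(B·H_P·Bᵀ) = P·Q → P ∣ D_π(B) − π·Q`.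

Here `D_π(B) := epsCoeff 1 (hessGenMinor (B.map C) (B.map C) (P + επ))` is the `ε¹`-coefficient of
the deformed generalised Hessian minor `det(B · H_{P+επ} · Bᵀ) ∈ ℂ[ε][x]` — the tree's rendering of
`D_π det(H_P|_F)` — and `epsCoeff k` (the one helper definition of this file) takes the
`ε^k`-coefficient of a polynomial over `ℂ[ε]` coefficientwise.

## Proofs

(Z1): expand eq. (2) to first order in the apex coefficient `p_d` (`lmrRemainder_firstOrder_apex`,
rung (Z0) file) at a root `u` of `P`, where over `ℂ[ε]` one has `p_d = ε·π(u)`,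
`p_{d−1} ≡ ⟨∇P(u), v⟩`, `q_e = det(B·H_{P+επ}·Bᵀ)(u) = ε·D_π(B)(u) + O(ε²)` (its `ε⁰`-term is
`P(u)Q(u) = 0`) and `q_{e−1} ≡ ⟨∇(PQ)(u), v⟩ = Q(u)⟨∇P(u), v⟩`; this gives (Zar) at a root. With
`v = e_i` for an `i` with `∂_iP ≠ 0` the product `(D_π(B) − πQ)·∂_iP` vanishes on `Z(P)`, hence is
divisible by the prime `P` (the tree's Nullstellensatz `dvd_of_prime_of_forall_eval_eq_zero`), and
`P ∤ ∂_iP` (degrees) — exactly the pattern of rung (Z0).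
(Z2): base-change the equation to the ring `ℂ[ε]/(ε²)` (`map_lmrDualEquation`); there the deformed
minor equals `(P + επ)(Q + εR)` (`exists_eq_epsCoeff_add_sq_mul`: `G = G₀ + εG₁ + ε²H`), so
`P + επ` divides it and the equation vanishes (`lmrDualEquation_eq_zero_of_dvd`, valid over any
commutative ring); an element of `ℂ[ε]` vanishing modulo `ε²` has zero `ε¹`-coefficient
(`Polynomial.X_pow_dvd_iff`).

Theorems only, plus the helper definition `epsCoeff`; no named facts. Honest framing: infrastructure
of the LMR13-A ladder (Lemma 3.3.2, Lemma 3.4.1, Prop. 3.4.2 ⇒ and the tangent half of Thm. 3.1.1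
all start from (Zar)); VP ≠ VNP is NOT proved and nothing here is progress on it.

## References

* J. M. Landsberg, L. Manivel, N. Ressayre, *Hypersurfaces with degenerate duals and the geometric
  complexity theory program*, Comment. Math. Helv. 88 (2013) 469–484, §3.3 (p. 477), §2.2 eq. (2)
  (p. 473); arXiv:1004.4802, `p0006.txt:L57–66`. [cite: LandsbergManivelRessayre2013, §3.3 (p. 477)]

## Tree

`lmrZariskiTangent`, `firstOrderDeformation`, `lmrDualEquation`, `lmrRemainder`, `binCoeff`,
`lmrDualScheme` (`LMR13DualVarieties`); `lmrRemainder_firstOrder_apex`, `binCoeff_self_eq_eval`,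
`binCoeff_pred_eq_sum`, `dvd_hessGenMinor_of_prime_of_mem_lmrDualScheme` (`LMR13FirstOrderIdentity`);
`map_lmrDualEquation`, `map_binCoeff`, `lmrDualEquation_eq_zero_of_dvd` (`LMR13DualSchemeDetProofs`);
`binCoeff_C_mul` (`LMR13SubspaceTangentExcess`); `hessGenMinor`, `map_hessGenMinor`
(`BorderDcQuadraticBoundProofs`); `isHomogeneous_hessGenMinor` (`LMRDetIdealModuleWeight`);
`dvd_of_prime_of_forall_eval_eq_zero` (`LMRDetIdealModuleProofs`). Mathlib: `Polynomial.divX`,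
`Polynomial.X_mul_divX_add`, `Polynomial.X_pow_dvd_iff`, `Ideal.Quotient.mk`, `MvPolynomial.pderiv`,
`IsHomogeneous.sum_X_mul_pderiv` (Euler).
-/

noncomputable section

open MvPolynomial

namespace Literature.Computability.AlgebraicComplexity

/-! ### The coefficientwise `ε^k`-coefficient of a polynomial over `A[ε]` -/

section EpsCoeff

variable {R : Type*} [CommSemiring R] {σ : Type*}

/-- The coefficientwise `ε^k`-coefficient of a polynomial `G ∈ A[ε][x_σ]`: the polynomial over `A`
whose coefficient at each monomial is the `ε^k`-coefficient of the corresponding coefficient of `G`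
(so that `G = Σ_k ε^k · epsCoeff k G`; LMR 2013 §3.3 expands `det(H_{P_ε}|_F)` for the curve
`P_ε = P + επ + ε²τ + O(ε³)` in powers of `ε`, `paper:arxiv-1004.4802 p0006.txt:L59–66`).
[cite: LandsbergManivelRessayre2013, §3.3 (p. 477)] -/
def epsCoeff (k : ℕ) (G : MvPolynomial σ (Polynomial R)) : MvPolynomial σ R :=
  ∑ m ∈ G.support, monomial m ((coeff m G).coeff k)

/-- The coefficients of `epsCoeff k G` (unfolding lemma). [cite: LandsbergManivelRessayre2013, §3.3 (p. 477)] -/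
@[simp]
theorem coeff_epsCoeff (k : ℕ) (G : MvPolynomial σ (Polynomial R)) (m : σ →₀ ℕ) :
    coeff m (epsCoeff k G) = (coeff m G).coeff k := by
  classical
  rw [epsCoeff, coeff_sum]
  simp only [coeff_monomial]
  rw [Finset.sum_ite_eq']
  split_ifs with h
  · rfl
  · rw [notMem_support_iff.mp h, Polynomial.coeff_zero]

/-- `epsCoeff k` is additive. [cite: LandsbergManivelRessayre2013, §3.3 (p. 477)] -/
theorem epsCoeff_add (k : ℕ) (G H : MvPolynomial σ (Polynomial R)) :
    epsCoeff k (G + H) = epsCoeff k G + epsCoeff k H := by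
  ext m
  simp only [coeff_epsCoeff, coeff_add, Polynomial.coeff_add]

/-- `epsCoeff k` commutes with subtraction. [cite: LandsbergManivelRessayre2013, §3.3 (p. 477)] -/
theorem epsCoeff_sub {R : Type*} [CommRing R] (k : ℕ) (G H : MvPolynomial σ (Polynomial R)) :
    epsCoeff k (G - H) = epsCoeff k G - epsCoeff k H := by
  ext m
  simp only [coeff_epsCoeff, coeff_sub, Polynomial.coeff_sub]

/-- `epsCoeff k` of a monomial. [cite: LandsbergManivelRessayre2013, §3.3 (p. 477)] -/
theorem epsCoeff_monomial (k : ℕ) (m : σ →₀ ℕ) (c : Polynomial R) :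
    epsCoeff k (monomial m c) = monomial m (c.coeff k) := by
  classical
  ext m'
  simp only [coeff_epsCoeff, coeff_monomial]
  split_ifs <;> simp

/-- A polynomial with constant coefficients (in `ε`) has `ε⁰`-coefficient itself and no higher ones.
[cite: LandsbergManivelRessayre2013, §3.3 (p. 477)] -/
theorem epsCoeff_map_C (k : ℕ) (g : MvPolynomial σ R) :
    epsCoeff k (MvPolynomial.map Polynomial.C g) = if k = 0 then g else 0 := by
  ext m
  simp only [coeff_epsCoeff, coeff_map, Polynomial.coeff_C]
  split_ifs <;> simp

/-- Multiplication by `ε` shifts the coefficients. [cite: LandsbergManivelRessayre2013, §3.3 (p. 477)] -/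
theorem epsCoeff_C_X_mul_succ (k : ℕ) (G : MvPolynomial σ (Polynomial R)) :
    epsCoeff (k + 1) (C Polynomial.X * G) = epsCoeff k G := by
  ext m
  simp only [coeff_epsCoeff, coeff_C_mul, Polynomial.coeff_X_mul]

/-- Multiplication by `ε` kills the `ε⁰`-coefficient. [cite: LandsbergManivelRessayre2013, §3.3 (p. 477)] -/
theorem epsCoeff_zero_C_X_mul (G : MvPolynomial σ (Polynomial R)) :
    epsCoeff 0 (C Polynomial.X * G) = 0 := by
  ext m
  simp only [coeff_epsCoeff, coeff_C_mul, Polynomial.mul_coeff_zero, Polynomial.coeff_X_zero,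
    zero_mul, coeff_zero]

/-- The `ε⁰`-coefficient is the base change along `ε ↦ 0` (a ring homomorphism). [cite: LandsbergManivelRessayre2013, §3.3 (p. 477)] -/
theorem epsCoeff_zero_eq_map (G : MvPolynomial σ (Polynomial R)) :
    epsCoeff 0 G = MvPolynomial.map (Polynomial.constantCoeff : Polynomial R →+* R) G := by
  ext m
  simp only [coeff_epsCoeff, coeff_map, Polynomial.constantCoeff_apply]

/-- The `ε⁰`-coefficient commutes with partial derivatives. [cite: LandsbergManivelRessayre2013, §3.3 (p. 477)] -/
theorem epsCoeff_zero_pderiv (i : σ) (G : MvPolynomial σ (Polynomial R)) :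
    epsCoeff 0 (pderiv i G) = pderiv i (epsCoeff 0 G) := by
  rw [epsCoeff_zero_eq_map, epsCoeff_zero_eq_map, pderiv_map]

/-- **Expansion to first order in `ε`**: every `G ∈ A[ε][x_σ]` is
`G = G₀ + ε G₁ + ε² H` with `G₀ = epsCoeff 0 G`, `G₁ = epsCoeff 1 G` (LMR 2013 §3.3: "we can
neglect the terms of order two", `paper:arxiv-1004.4802 p0006.txt:L62`).
[cite: LandsbergManivelRessayre2013, §3.3 (p. 477)] -/
theorem exists_eq_epsCoeff_add_sq_mul (G : MvPolynomial σ (Polynomial R)) :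
    ∃ H : MvPolynomial σ (Polynomial R),
      G = MvPolynomial.map Polynomial.C (epsCoeff 0 G) +
        C Polynomial.X * MvPolynomial.map Polynomial.C (epsCoeff 1 G) + C (Polynomial.X ^ 2) * H := by
  induction G using MvPolynomial.induction_on' with
  | monomial m a =>
    refine ⟨monomial m (a.divX.divX), ?_⟩
    rw [epsCoeff_monomial, epsCoeff_monomial, map_monomial, map_monomial, C_mul_monomial,
      C_mul_monomial, ← map_add, ← map_add]
    congr 1
    have h1 := Polynomial.X_mul_divX_add a
    have h2 := Polynomial.X_mul_divX_add a.divX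
    rw [Polynomial.coeff_divX, zero_add] at h2
    calc a = Polynomial.X * a.divX + Polynomial.C (a.coeff 0) := h1.symm
      _ = Polynomial.X * (Polynomial.X * a.divX.divX + Polynomial.C (a.coeff 1)) +
            Polynomial.C (a.coeff 0) := by rw [h2]
      _ = _ := by ring
  | add p q hp hq =>
    obtain ⟨H₁, h₁⟩ := hp
    obtain ⟨H₂, h₂⟩ := hq
    refine ⟨H₁ + H₂, ?_⟩
    rw [epsCoeff_add, epsCoeff_add, map_add, map_add]
    conv_lhs => rw [h₁, h₂]
    ring

/-- A homogeneous polynomial over `A[ε]` has homogeneous `ε^k`-coefficients. [cite: LandsbergManivelRessayre2013, §3.3 (p. 477)] -/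
theorem IsHomogeneous.epsCoeff {G : MvPolynomial σ (Polynomial R)} {n : ℕ}
    (hG : G.IsHomogeneous n) (k : ℕ) : (epsCoeff k G).IsHomogeneous n := by
  intro m hm
  rw [coeff_epsCoeff] at hm
  exact hG fun h => hm (by rw [h, Polynomial.coeff_zero])

end EpsCoeff

/-! ### Values and plane-restriction coefficients to first order in `ε` -/

section Orders

variable {R : Type*} [CommRing R] {σ : Type*}

/-- In `ε`-degree one: `(f · g)₁ = f₀ g₁ + f₁ g₀`. [folklore] -/
private theorem coeff_one_mul (f g : Polynomial R) :
    (f * g).coeff 1 = f.coeff 0 * g.coeff 1 + f.coeff 1 * g.coeff 0 := by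
  conv_lhs => rw [← Polynomial.X_mul_divX_add f]
  rw [add_mul, Polynomial.coeff_add, Polynomial.coeff_C_mul, mul_assoc, Polynomial.coeff_X_mul,
    Polynomial.mul_coeff_zero, Polynomial.coeff_divX, zero_add]
  ring

/-- `(ε · g)₁ = g₀`. [folklore] -/
private theorem coeff_one_X_mul (g : Polynomial R) : (Polynomial.X * g).coeff 1 = g.coeff 0 :=
  Polynomial.coeff_X_mul g 0

/-- `(ε² · g)₁ = 0`. [folklore] -/
private theorem coeff_one_X_sq_mul (g : Polynomial R) : (Polynomial.X ^ 2 * g).coeff 1 = 0 := by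
  rw [Polynomial.coeff_X_pow_mul']
  simp

/-- Base change along `A → A[ε]` commutes with evaluation: `F(C u) = C(F(u))`. [cite: LandsbergManivelRessayre2013, §3.3 (p. 477)] -/
theorem eval_C_comp_map_C (x : σ → R) (F : MvPolynomial σ R) :
    eval (fun i => Polynomial.C (x i)) (MvPolynomial.map Polynomial.C F) =
      Polynomial.C (eval x F) := by
  induction F using MvPolynomial.induction_on with
  | C a => simp
  | add p q hp hq => simp [hp, hq]
  | mul_X p i hp => simp [hp]

/-- The `ε⁰`-term of a value at a point with constant coordinates: `G(C u)₀ = G₀(u)`. [cite: LandsbergManivelRessayre2013, §3.3 (p. 477)] -/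
theorem coeff_zero_eval_C_comp (x : σ → R) (G : MvPolynomial σ (Polynomial R)) :
    (eval (fun i => Polynomial.C (x i)) G).coeff 0 = eval x (epsCoeff 0 G) := by
  obtain ⟨H, hG⟩ := exists_eq_epsCoeff_add_sq_mul G
  conv_lhs => rw [hG]
  simp only [map_add, map_mul, eval_C, eval_C_comp_map_C, Polynomial.coeff_add,
    Polynomial.coeff_C_zero, Polynomial.mul_coeff_zero, Polynomial.coeff_X_zero, zero_mul, add_zero,
    Polynomial.coeff_X_pow, if_neg (two_ne_zero' ℕ).symm]

/-- The `ε¹`-term of a value at a point with constant coordinates: `G(C u)₁ = G₁(u)`. [cite: LandsbergManivelRessayre2013, §3.3 (p. 477)] -/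
theorem coeff_one_eval_C_comp (x : σ → R) (G : MvPolynomial σ (Polynomial R)) :
    (eval (fun i => Polynomial.C (x i)) G).coeff 1 = eval x (epsCoeff 1 G) := by
  obtain ⟨H, hG⟩ := exists_eq_epsCoeff_add_sq_mul G
  conv_lhs => rw [hG]
  rw [map_add, map_add, map_mul, map_mul, eval_C, eval_C, eval_C_comp_map_C, eval_C_comp_map_C,
    Polynomial.coeff_add, Polynomial.coeff_add, coeff_one_X_mul, Polynomial.coeff_C_zero,
    coeff_one_X_sq_mul, Polynomial.coeff_C, if_neg one_ne_zero, zero_add, add_zero]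

/-- `binCoeff` is additive in the form. [cite: LandsbergManivelRessayre2013, §2.2 (p. 473)] -/
theorem binCoeff_add (e : ℕ) (u v : σ → R) (f g : MvPolynomial σ R) (j : ℕ) :
    binCoeff e u v (f + g) j = binCoeff e u v f j + binCoeff e u v g j := by
  simp only [binCoeff, binRestr, map_add, coeff_add]

/-- The `ε⁰`-term of a plane-restriction coefficient over `A[ε]` with constant data:
`p_j(G)(C u, C v)₀ = p_j(G₀)(u, v)`. [cite: LandsbergManivelRessayre2013, §2.2 (p. 473)] -/
theorem coeff_zero_binCoeff_C_comp (e : ℕ) (u v : σ → R) (G : MvPolynomial σ (Polynomial R))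
    (j : ℕ) :
    (binCoeff e (fun i => Polynomial.C (u i)) (fun i => Polynomial.C (v i)) G j).coeff 0 =
      binCoeff e u v (epsCoeff 0 G) j := by
  obtain ⟨H, hG⟩ := exists_eq_epsCoeff_add_sq_mul G
  conv_lhs => rw [hG]
  rw [binCoeff_add, binCoeff_add, binCoeff_C_mul, binCoeff_C_mul,
    ← map_binCoeff Polynomial.C e u v, ← map_binCoeff Polynomial.C e u v, Polynomial.coeff_add,
    Polynomial.coeff_add, Polynomial.coeff_C_zero, Polynomial.mul_coeff_zero, Polynomial.coeff_X_zero,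
    zero_mul, add_zero, Polynomial.mul_coeff_zero, Polynomial.coeff_X_pow,
    if_neg (two_ne_zero' ℕ).symm, zero_mul, add_zero]

/-- The `ε¹`-term of a plane-restriction coefficient over `A[ε]` with constant data:
`p_j(G)(C u, C v)₁ = p_j(G₁)(u, v)`. [cite: LandsbergManivelRessayre2013, §2.2 (p. 473)] -/
theorem coeff_one_binCoeff_C_comp (e : ℕ) (u v : σ → R) (G : MvPolynomial σ (Polynomial R))
    (j : ℕ) :
    (binCoeff e (fun i => Polynomial.C (u i)) (fun i => Polynomial.C (v i)) G j).coeff 1 =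
      binCoeff e u v (epsCoeff 1 G) j := by
  obtain ⟨H, hG⟩ := exists_eq_epsCoeff_add_sq_mul G
  conv_lhs => rw [hG]
  rw [binCoeff_add, binCoeff_add, binCoeff_C_mul, binCoeff_C_mul,
    ← map_binCoeff Polynomial.C e u v, ← map_binCoeff Polynomial.C e u v, Polynomial.coeff_add,
    Polynomial.coeff_add, coeff_one_X_mul, Polynomial.coeff_C_zero, coeff_one_X_sq_mul,
    Polynomial.coeff_C, if_neg one_ne_zero, zero_add, add_zero]

end Orders

/-! ### The first-order deformation `P + επ` and its generalised Hessian minors -/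

section Deformation

variable {σ : Type*}

/-- `(P + επ)(C u) = C(P(u)) + ε C(π(u))`. [cite: LandsbergManivelRessayre2013, §3.3 (p. 477)] -/
theorem eval_C_comp_firstOrderDeformation (x : σ → ℂ) (P π : MvPolynomial σ ℂ) :
    eval (fun i => Polynomial.C (x i)) (firstOrderDeformation P π) =
      Polynomial.C (eval x P) + Polynomial.X * Polynomial.C (eval x π) := by
  rw [firstOrderDeformation, map_add, map_mul, eval_C, eval_C_comp_map_C, eval_C_comp_map_C]

/-- Partial derivatives of the deformation: `∂_i(P + επ) = ∂_iP + ε ∂_iπ`.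
[cite: LandsbergManivelRessayre2013, §3.3 (p. 477)] -/
theorem pderiv_firstOrderDeformation (i : σ) (P π : MvPolynomial σ ℂ) :
    pderiv i (firstOrderDeformation P π) = firstOrderDeformation (pderiv i P) (pderiv i π) := by
  rw [firstOrderDeformation, firstOrderDeformation, map_add, pderiv_C_mul, pderiv_map, pderiv_map]

/-- The deformation of a form of degree `d` by a form of degree `d` is a form of degree `d` over
`ℂ[ε]`. [cite: LandsbergManivelRessayre2013, §3.3 (p. 477)] -/
theorem isHomogeneous_firstOrderDeformation {P π : MvPolynomial σ ℂ} {d : ℕ}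
    (hP : P.IsHomogeneous d) (hπ : π.IsHomogeneous d) :
    (firstOrderDeformation P π).IsHomogeneous d :=
  (hP.map _).add ((hπ.map _).C_mul _)

/-- `(P + επ)₀ = P`. [cite: LandsbergManivelRessayre2013, §3.3 (p. 477)] -/
theorem epsCoeff_zero_firstOrderDeformation (P π : MvPolynomial σ ℂ) :
    epsCoeff 0 (firstOrderDeformation P π) = P := by
  rw [firstOrderDeformation, epsCoeff_add, epsCoeff_map_C, if_pos rfl, epsCoeff_zero_C_X_mul,
    add_zero]

/-- `(P + επ)₁ = π`. [cite: LandsbergManivelRessayre2013, §3.3 (p. 477)] -/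
theorem epsCoeff_one_firstOrderDeformation (P π : MvPolynomial σ ℂ) :
    epsCoeff 1 (firstOrderDeformation P π) = π := by
  rw [firstOrderDeformation, epsCoeff_add, epsCoeff_map_C, if_neg one_ne_zero, zero_add,
    show (1 : ℕ) = 0 + 1 from rfl, epsCoeff_C_X_mul_succ, epsCoeff_map_C, if_pos rfl]

/-- `(P + επ)|_{ε = 0} = P` (base change along `ε ↦ 0`). [cite: LandsbergManivelRessayre2013, §3.3 (p. 477)] -/
theorem map_constantCoeff_firstOrderDeformation (P π : MvPolynomial σ ℂ) :
    MvPolynomial.map (Polynomial.constantCoeff : Polynomial ℂ →+* ℂ) (firstOrderDeformation P π) =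
      P := by
  rw [← epsCoeff_zero_eq_map, epsCoeff_zero_firstOrderDeformation]

variable [Fintype σ]

/-- **The `ε⁰`-term of `det(H_{P+επ}|_F)` is `det(H_P|_F)`.**
[cite: LandsbergManivelRessayre2013, §3.3 (p. 477)] -/
theorem epsCoeff_zero_hessGenMinor_firstOrderDeformation {r : ℕ} (B : Matrix (Fin r) σ ℂ)
    (P π : MvPolynomial σ ℂ) :
    epsCoeff 0 (hessGenMinor (B.map Polynomial.C) (B.map Polynomial.C) (firstOrderDeformation P π)) =
      hessGenMinor B B P := by
  classical
  have hB : (B.map (Polynomial.C : ℂ →+* Polynomial ℂ)).map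
      (Polynomial.constantCoeff : Polynomial ℂ →+* ℂ) = B :=
    Matrix.ext fun a b => by simp
  rw [epsCoeff_zero_eq_map, map_hessGenMinor, hB, map_constantCoeff_firstOrderDeformation]

/-- The `ε⁰`-term of the equation `E_{B,u,v}(P + επ)` is the equation `E_{B,u,v}(P)` itself.
[cite: LandsbergManivelRessayre2013, §3.3 (p. 477)] -/
theorem coeff_zero_lmrDualEquation_firstOrderDeformation (κ d : ℕ) (B : Matrix (Fin (κ + 3)) σ ℂ)
    (u v : σ → ℂ) (P π : MvPolynomial σ ℂ) :
    (lmrDualEquation κ d (B.map (Polynomial.C : ℂ →+* Polynomial ℂ))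
        (fun i => Polynomial.C (u i)) (fun i => Polynomial.C (v i))
        (firstOrderDeformation P π)).coeff 0 = lmrDualEquation κ d B u v P := by
  classical
  have hB : (B.map (Polynomial.C : ℂ →+* Polynomial ℂ)).map
      (Polynomial.constantCoeff : Polynomial ℂ →+* ℂ) = B :=
    Matrix.ext fun a b => by simp
  rw [← Polynomial.constantCoeff_apply, map_lmrDualEquation, hB,
    map_constantCoeff_firstOrderDeformation]
  simp only [Polynomial.constantCoeff_apply, Polynomial.coeff_C_zero]

end Deformation

/-! ### (Zar) at a root of `P`: the `ε¹`-coefficient of `E_{B,u,v}(P + επ)` -/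

section FirstOrderIdentity

variable {σ : Type*} [Fintype σ]

/-- A nonzero form of positive degree over `ℂ` has a nonzero partial derivative (Euler's identity).
[folklore] -/
private theorem exists_pderiv_ne_zero_of_isHomogeneous {P : MvPolynomial σ ℂ} {d : ℕ}
    (hP : P.IsHomogeneous d) (hd : d ≠ 0) (hP0 : P ≠ 0) : ∃ i, pderiv i P ≠ 0 := by
  by_contra h
  simp only [not_exists, not_not] at h
  have heuler := hP.sum_X_mul_pderiv
  rw [Finset.sum_eq_zero fun i _ => by rw [h i, mul_zero], nsmul_eq_mul] at heuler
  rcases mul_eq_zero.1 heuler.symm with h1 | h1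
  · exact hd (Nat.cast_eq_zero.1 h1)
  · exact hP0 h1

omit [Fintype σ] in
/-- A form does not divide its own nonzero partial derivatives (degrees). [folklore] -/
private theorem not_dvd_pderiv_of_isHomogeneous {P : MvPolynomial σ ℂ} {d : ℕ}
    (hP : P.IsHomogeneous d) (hP0 : P ≠ 0) {i : σ} (hi : pderiv i P ≠ 0) : ¬ P ∣ pderiv i P := by
  rintro ⟨c, hc⟩
  have hc0 : c ≠ 0 := fun h => hi (by rw [hc, h, mul_zero])
  have hdeg := congrArg totalDegree hc
  rw [totalDegree_mul_of_isDomain hP0 hc0, hP.totalDegree hP0,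
    (hP.pderiv (i := i)).totalDegree hi] at hdeg
  have hd : d ≠ 0 := by
    rintro rfl
    have hPc : P = C (coeff 0 P) :=
      (totalDegree_eq_zero_iff_eq_C).1 (Nat.le_zero.1 hP.totalDegree_le)
    exact hi (by rw [hPc, pderiv_C])
  omega

/-- **(Zar) at a root** (LMR 2013 §3.3, `paper:arxiv-1004.4802 p0006.txt:L57–66`; journal p. 477:
"We differentiate the condition that `P` divides `det(H_P|_F)` … `D_π det(H_P|_F) ≡ π Q_F (mod P)`"),
in the tree's language of the remainder equations `E_{B,u,v}`: if `P, π` are forms of degree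
`d ≥ 3`, `det(H_P|_F) = P · Q` for the frame `F = rows(B)`, and `u ∈ Z(P)`, then the
`ε¹`-coefficient of `E_{B,u,v}(P + επ)` is
`(−1)^{e−d+1} · ⟨∇P(u), v⟩^{e−d+1} · (D_π(B) − π·Q)(u)`, `e = (k+3)(d−2)`, where
`D_π(B) = epsCoeff 1 (det((B·H_{P+επ}·Bᵀ)))` is the `ε¹`-coefficient of the deformed minor.
Proof: eq. (2) to first order in the apex coefficient (`lmrRemainder_firstOrder_apex`) with
`p_d = ε·π(u)`, `p_{d−1} ≡ ⟨∇P(u),v⟩`, `q_e = ε·D_π(B)(u) + O(ε²)` (as `Q_F(u) = P(u)Q(u) = 0`) and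
`q_{e−1} ≡ ⟨∇(PQ)(u), v⟩ = Q(u)·⟨∇P(u),v⟩ (mod ε)`. [cite: LandsbergManivelRessayre2013, §3.3 (p. 477)] -/
theorem coeff_one_lmrDualEquation_firstOrderDeformation_of_eval_eq_zero {κ d : ℕ} (hd : 3 ≤ d)
    {P π Q : MvPolynomial σ ℂ} (hP : P.IsHomogeneous d) (hπ : π.IsHomogeneous d)
    (B : Matrix (Fin (κ + 3)) σ ℂ) (hQ : hessGenMinor B B P = P * Q) (u v : σ → ℂ)
    (hu : eval u P = 0) :
    (lmrDualEquation κ d (B.map (Polynomial.C : ℂ →+* Polynomial ℂ))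
        (fun i => Polynomial.C (u i)) (fun i => Polynomial.C (v i))
        (firstOrderDeformation P π)).coeff 1 =
      (-1) ^ ((κ + 3) * (d - 2) - d + 1) *
        (∑ i, v i * eval u (pderiv i P)) ^ ((κ + 3) * (d - 2) - d + 1) *
        eval u (epsCoeff 1 (hessGenMinor (B.map (Polynomial.C : ℂ →+* Polynomial ℂ))
          (B.map (Polynomial.C : ℂ →+* Polynomial ℂ)) (firstOrderDeformation P π)) - π * Q) := by
  classical
  -- notation
  set e := (κ + 3) * (d - 2) with he
  have hde : d ≤ e := by
    have : 3 * (d - 2) ≤ (κ + 3) * (d - 2) := Nat.mul_le_mul_right _ (by omega)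
    omega
  set u' : σ → Polynomial ℂ := fun i => Polynomial.C (u i) with hu'
  set v' : σ → Polynomial ℂ := fun i => Polynomial.C (v i) with hv'
  set Pε := firstOrderDeformation P π with hPε_def
  set G := hessGenMinor (B.map (Polynomial.C : ℂ →+* Polynomial ℂ))
    (B.map (Polynomial.C : ℂ →+* Polynomial ℂ)) Pε with hG_def
  have hPε : Pε.IsHomogeneous d := isHomogeneous_firstOrderDeformation hP hπ
  have hGh : G.IsHomogeneous e := isHomogeneous_hessGenMinor _ _ hPε
  set g : ℂ := ∑ i, v i * eval u (pderiv i P) with hg_def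
  -- the data of eq. (2) over `ℂ[ε]`
  set p : ℕ → Polynomial ℂ := binCoeff d u' v' Pε with hp_def
  set q : ℕ → Polynomial ℂ := binCoeff e u' v' G with hq_def
  -- `p_d = ε π(u)`
  have hpd : p d = Polynomial.X * Polynomial.C (eval u π) := by
    rw [hp_def, binCoeff_self_eq_eval hPε, hPε_def, eval_C_comp_firstOrderDeformation, hu, map_zero,
      zero_add]
  -- `p_{d-1} ≡ ⟨∇P(u), v⟩`
  have hpd1 : (p (d - 1)).coeff 0 = g := by
    rw [hp_def, binCoeff_pred_eq_sum hPε (by omega), Polynomial.finsetSum_coeff, hg_def]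
    refine Finset.sum_congr rfl fun i _ => ?_
    rw [hPε_def, pderiv_firstOrderDeformation, eval_C_comp_firstOrderDeformation,
      Polynomial.coeff_C_mul, Polynomial.coeff_add, Polynomial.coeff_C_zero,
      Polynomial.mul_coeff_zero, Polynomial.coeff_X_zero, zero_mul, add_zero]
  -- `q_e = ε D(u) + O(ε²)`
  have hqe0 : (q e).coeff 0 = 0 := by
    rw [hq_def, binCoeff_self_eq_eval hGh, coeff_zero_eval_C_comp, hG_def, hPε_def,
      epsCoeff_zero_hessGenMinor_firstOrderDeformation, hQ, map_mul, hu, zero_mul]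
  have hqe1 : (q e).coeff 1 = eval u (epsCoeff 1 G) := by
    rw [hq_def, binCoeff_self_eq_eval hGh, coeff_one_eval_C_comp]
  -- `q_{e-1} ≡ Q(u) ⟨∇P(u), v⟩`
  have hqe1' : (q (e - 1)).coeff 0 = eval u Q * g := by
    rw [hq_def, binCoeff_pred_eq_sum hGh (by omega), Polynomial.finsetSum_coeff, hg_def,
      Finset.mul_sum]
    refine Finset.sum_congr rfl fun i _ => ?_
    rw [Polynomial.coeff_C_mul, coeff_zero_eval_C_comp, epsCoeff_zero_pderiv, hG_def, hPε_def,
      epsCoeff_zero_hessGenMinor_firstOrderDeformation, hQ, Derivation.leibniz, smul_eq_mul,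
      smul_eq_mul, map_add, map_mul, map_mul, hu]
    ring
  -- the three terms of `lmrRemainder_firstOrder_apex` in `ε`-degree one
  have hT1 : ∀ Y : Polynomial ℂ, (q e * Y).coeff 1 = eval u (epsCoeff 1 G) * Y.coeff 0 := by
    intro Y
    rw [coeff_one_mul, hqe0, hqe1, zero_mul, zero_add]
  have hT2 : ∀ Y : Polynomial ℂ, (p d * Y).coeff 1 = eval u π * Y.coeff 0 := by
    intro Y
    rw [hpd, mul_assoc, coeff_one_X_mul, Polynomial.coeff_C_mul]
  have hT3 : ∀ Y : Polynomial ℂ, (p d ^ 2 * Y).coeff 1 = 0 := by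
    intro Y
    rw [hpd, mul_pow, mul_assoc, coeff_one_X_sq_mul]
  -- constant terms as evaluations at `ε = 0`
  have e1 : Polynomial.eval 0 (p (d - 1)) = g := by rw [← Polynomial.coeff_zero_eq_eval_zero, hpd1]
  have e2 : Polynomial.eval 0 (q e) = 0 := by rw [← Polynomial.coeff_zero_eq_eval_zero, hqe0]
  have e3 : Polynomial.eval 0 (q (e - 1)) = eval u Q * g := by
    rw [← Polynomial.coeff_zero_eq_eval_zero, hqe1']
  -- expand eq. (2)
  show (lmrRemainder d e p q).coeff 1 = _
  rw [lmrRemainder_firstOrder_apex (by omega) hde, Polynomial.coeff_add, Polynomial.coeff_add,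
    hT1, hT2, hT3, add_zero, Polynomial.coeff_zero_eq_eval_zero, Polynomial.coeff_zero_eq_eval_zero]
  simp only [Polynomial.eval_mul, Polynomial.eval_pow, Polynomial.eval_neg, Polynomial.eval_one,
    Polynomial.eval_add, Polynomial.eval_natCast, e1, e2, e3, mul_zero, zero_mul, zero_add]
  rw [map_sub, map_mul, show e - d + 1 = (e - d) + 1 by omega, pow_succ, pow_succ]
  ring

/-- **(Z1) The first-order identity (Zar)** (LMR 2013 §3.3, `paper:arxiv-1004.4802 p0006.txt:L57–66`,
journal p. 477: "when `π` belongs to this [Zariski tangent] space … `D_π det(H_P|_F) ≡ π·Q_F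
(mod P)`"): for a PRIME form `P` of degree `d ≥ 3` with `det(H_P|_F) = P·Q` (`F = rows(B)`) and
a Zariski tangent vector `π ∈ T̂_{[P]} 𝒟ual_{k,d,N}` (`lmrZariskiTangent`: the `ε¹`-coefficients of
all remainder equations `E_{B,u,v}(P+επ)` vanish), `P` divides `D_π(B) − π·Q`, where
`D_π(B) = epsCoeff 1 (det(B·H_{P+επ}·Bᵀ))` is the `ε¹`-coefficient of the deformed minor. Proof:
by (Zar) at a root, `⟨∇P(u), e_i⟩^{e−d+1}·(D_π(B) − πQ)(u) = 0` on `Z(P)`, so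
`(D_π(B) − πQ)·∂_iP` vanishes on `Z(P)` and is divisible by the prime `P`
(`dvd_of_prime_of_forall_eval_eq_zero`), while `P ∤ ∂_iP` for `∂_iP ≠ 0`.
[cite: LandsbergManivelRessayre2013, §3.3 (p. 477)] -/
theorem dvd_firstOrder_of_mem_lmrZariskiTangent {κ d : ℕ} (hd : 3 ≤ d) {P π Q : MvPolynomial σ ℂ}
    (hprime : Prime P) (hP : P.IsHomogeneous d) (B : Matrix (Fin (κ + 3)) σ ℂ)
    (hQ : hessGenMinor B B P = P * Q) (hπ : π ∈ lmrZariskiTangent κ d P) :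
    P ∣ epsCoeff 1 (hessGenMinor (B.map (Polynomial.C : ℂ →+* Polynomial ℂ))
        (B.map (Polynomial.C : ℂ →+* Polynomial ℂ)) (firstOrderDeformation P π)) - π * Q := by
  classical
  set D := epsCoeff 1 (hessGenMinor (B.map (Polynomial.C : ℂ →+* Polynomial ℂ))
    (B.map (Polynomial.C : ℂ →+* Polynomial ℂ)) (firstOrderDeformation P π)) with hD
  obtain ⟨i, hi⟩ := exists_pderiv_ne_zero_of_isHomogeneous hP (by omega) hprime.ne_zero
  have hvan : ∀ x : σ → ℂ, eval x P = 0 → eval x ((D - π * Q) * pderiv i P) = 0 := by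
    intro x hx
    have h := hπ.2 B x (Pi.single i 1)
    rw [coeff_one_lmrDualEquation_firstOrderDeformation_of_eval_eq_zero hd hP hπ.1 B hQ x _ hx,
      ← hD] at h
    have hsum : ∑ j, (Pi.single i 1 : σ → ℂ) j * eval x (pderiv j P) = eval x (pderiv i P) := by
      rw [Finset.sum_eq_single i]
      · simp
      · intro j _ hji; simp [hji]
      · intro h; exact absurd (Finset.mem_univ i) h
    rw [hsum] at h
    rw [map_mul]
    rcases mul_eq_zero.1 h with h1 | h1
    · rcases mul_eq_zero.1 h1 with h2 | h2
      · exact absurd h2 (pow_ne_zero _ (neg_ne_zero.2 one_ne_zero))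
      · rw [(pow_eq_zero_iff'.1 h2).1, mul_zero]
    · rw [h1, zero_mul]
  have hdvd : P ∣ (D - π * Q) * pderiv i P := dvd_of_prime_of_forall_eval_eq_zero hprime hvan
  rcases hprime.dvd_or_dvd hdvd with h | h
  · exact h
  · exact absurd h (not_dvd_pderiv_of_isHomogeneous hP hprime.ne_zero hi)

/-! ### (Z2) The converse: divisibility to first order gives a Zariski tangent vector -/

/-- **(Z2), converse of (Zar)** (LMR 2013 §3.3, p. 477: "`P_ε` must divide `det(H_{P_ε}|_F)` …
we can neglect the terms of order two"): if `P, π` are forms of degree `d ≥ 3` and for every frame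
`B` there are `Q, R` with `det(H_P|_F) = P·Q` and `D_π(B) = π·Q + P·R`, then over `ℂ[ε]/(ε²)` the
deformed minor is `(P + επ)(Q + εR)`, so every remainder equation `E_{B,u,v}(P + επ)` vanishes
modulo `ε²` (`lmrDualEquation_eq_zero_of_dvd` over the ring `ℂ[ε]/(ε²)`, `map_lmrDualEquation`) —
its `ε¹`-coefficient vanishes: `π ∈ T̂_{[P]} 𝒟ual_{k,d,N}`. No primality needed.
[cite: LandsbergManivelRessayre2013, §3.3 (p. 477)] -/
theorem mem_lmrZariskiTangent_of_forall_exists {κ d : ℕ} (hd : 3 ≤ d) {P π : MvPolynomial σ ℂ}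
    (hP : P.IsHomogeneous d) (hπ : π.IsHomogeneous d)
    (h : ∀ B : Matrix (Fin (κ + 3)) σ ℂ, ∃ Q R : MvPolynomial σ ℂ, hessGenMinor B B P = P * Q ∧
      epsCoeff 1 (hessGenMinor (B.map (Polynomial.C : ℂ →+* Polynomial ℂ))
        (B.map (Polynomial.C : ℂ →+* Polynomial ℂ)) (firstOrderDeformation P π)) = π * Q + P * R) :
    π ∈ lmrZariskiTangent κ d P := by
  classical
  refine ⟨hπ, fun B u v => ?_⟩
  obtain ⟨Q, R, hQ, hD⟩ := h B
  set u' : σ → Polynomial ℂ := fun i => Polynomial.C (u i) with hu'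
  set v' : σ → Polynomial ℂ := fun i => Polynomial.C (v i) with hv'
  set Pε := firstOrderDeformation P π with hPε_def
  set Bε := B.map (Polynomial.C : ℂ →+* Polynomial ℂ) with hBε
  set G := hessGenMinor Bε Bε Pε with hG_def
  have hPε : Pε.IsHomogeneous d := isHomogeneous_firstOrderDeformation hP hπ
  -- the ring `ℂ[ε]/(ε²)`
  let I : Ideal (Polynomial ℂ) := Ideal.span {Polynomial.X ^ 2}
  let φ : Polynomial ℂ →+* Polynomial ℂ ⧸ I := Ideal.Quotient.mk I
  have hφX2 : φ (Polynomial.X ^ 2) = 0 :=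
    Ideal.Quotient.eq_zero_iff_mem.2 (Ideal.mem_span_singleton_self _)
  have hCX2 : (C (φ Polynomial.X) : MvPolynomial σ (Polynomial ℂ ⧸ I)) ^ 2 = 0 := by
    rw [← map_pow, ← map_pow, hφX2, map_zero]
  -- over it, `P_ε ∣ det(H_{P_ε}|_F)`
  have hdvd : MvPolynomial.map φ Pε ∣
      hessGenMinor (Bε.map φ) (Bε.map φ) (MvPolynomial.map φ Pε) := by
    rw [← map_hessGenMinor, ← hG_def]
    obtain ⟨H, hGH⟩ := exists_eq_epsCoeff_add_sq_mul G
    rw [hG_def, hBε, hPε_def, epsCoeff_zero_hessGenMinor_firstOrderDeformation, hQ, hD, ← hPε_def,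
      ← hBε, ← hG_def] at hGH
    refine ⟨MvPolynomial.map (φ.comp Polynomial.C) Q +
      C (φ Polynomial.X) * MvPolynomial.map (φ.comp Polynomial.C) R, ?_⟩
    rw [hGH, hPε_def, firstOrderDeformation]
    simp only [map_add, map_mul, MvPolynomial.map_map, map_C, hφX2, C_0, zero_mul, add_zero]
    linear_combination (-(MvPolynomial.map (φ.comp Polynomial.C) π *
      MvPolynomial.map (φ.comp Polynomial.C) R)) * hCX2
  -- hence the remainder equation vanishes modulo `ε²`
  have hE := lmrDualEquation_eq_zero_of_dvd hd (hPε.map φ) (Bε.map φ) (fun i => φ (u' i))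
    (fun i => φ (v' i)) hdvd
  rw [← map_lmrDualEquation] at hE
  have hmem : Polynomial.X ^ 2 ∣ lmrDualEquation κ d Bε u' v' Pε :=
    Ideal.mem_span_singleton.1 (Ideal.Quotient.eq_zero_iff_mem.1 hE)
  exact (Polynomial.X_pow_dvd_iff.1 hmem) 1 (by norm_num)

/-- **`T̂_{[P]} 𝒟ual_{k,d,N}` at a PRIME point, as divisibility** (LMR 2013 §3.3, p. 477; (Z1) and
(Z2) packaged): for a prime form `P ∈ 𝒟ual_{k,d,N}` of degree `d ≥ 3` — so that
`det(H_P|_F) = P · Q_F` for every `F` by (Z0), `dvd_hessGenMinor_of_prime_of_mem_lmrDualScheme` —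
a form `π` is a Zariski tangent vector at `[P]` iff `π` has degree `d` and
`P ∣ D_π(B) − π · Q` whenever `det(B·H_P·Bᵀ) = P · Q`.
[cite: LandsbergManivelRessayre2013, §3.3 (p. 477)] -/
theorem mem_lmrZariskiTangent_iff_dvd_of_prime {κ d : ℕ} (hd : 3 ≤ d) {P π : MvPolynomial σ ℂ}
    (hprime : Prime P) (hmem : P ∈ lmrDualScheme κ d) :
    π ∈ lmrZariskiTangent κ d P ↔ π.IsHomogeneous d ∧
      ∀ (B : Matrix (Fin (κ + 3)) σ ℂ) (Q : MvPolynomial σ ℂ), hessGenMinor B B P = P * Q →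
        P ∣ epsCoeff 1 (hessGenMinor (B.map (Polynomial.C : ℂ →+* Polynomial ℂ))
          (B.map (Polynomial.C : ℂ →+* Polynomial ℂ)) (firstOrderDeformation P π)) - π * Q := by
  refine ⟨fun hπ => ⟨hπ.1, fun B Q hQ =>
    dvd_firstOrder_of_mem_lmrZariskiTangent hd hprime hmem.1 B hQ hπ⟩, fun ⟨hπ, h⟩ => ?_⟩
  refine mem_lmrZariskiTangent_of_forall_exists hd hmem.1 hπ fun B => ?_
  obtain ⟨Q, hQ⟩ := dvd_hessGenMinor_of_prime_of_mem_lmrDualScheme hd hprime hmem B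
  obtain ⟨R, hR⟩ := h B Q hQ
  exact ⟨Q, R, hQ, by rw [← hR]; ring⟩

end FirstOrderIdentity

end Literature.Computability.AlgebraicComplexity

end
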